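import Mathlib
import Literature.Computability.AlgebraicComplexity.UniversalCircuitInt
import Literature.Computability.AlgebraicComplexity.BurgisserBooleanPartsA3Steps
import Literature.Computability.AlgebraicComplexity.ValiantClassesProofs
import Literature.Computability.AlgebraicComplexity.RazElusiveGeneralRouteProofs
import HarnessLib

/-!
# Route TwoAdicLadder — transfer of small circuits from 2-adically deep finite rings to `ℂ`
# (support for stmt-ValiantsHypothesis-5952 `LadderOfVH`)

The route's support item `LadderOfVH : ValiantsHypothesis → PrecisionLadder` ("refuting the
precision ladder refutes VH") rests on one transfer principle, proved here in general:

**If an integer polynomial `f₀ ∈ ℤ[x₁,…,x_N]` has circuits of size `≤ s` over commutative rings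
`R₀, R₁, R₂, …` in which `2` is nilpotent but `2^k ≠ 0` in `R_k`, then `f₀` has a circuit of size
`poly(N, deg f₀, s)` over `ℂ`** (`complexity_map_complex_le_of_twoAdic`).

Proof (the planner's ultraproduct argument, run with a prime ideal in place of an ultrafilter and
with Raz's universal circuit in place of Łoś's theorem):
* `exists_universalCircuit_int` (Literature): ONE integer polynomial `U(x, y)` of size
  `poly(N, d, s)` specialises, over EVERY commutative ring `R`, to every polynomial of degree `≤ d`
  and complexity `≤ s`; so "`f₀` has complexity `≤ s` over `R`" implies, and "`f₀ = U_ℂ(x, α)` for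
  some `α ∈ ℂ^p`" is implied by, the solvability over `R` resp. `ℂ` of ONE finite system of integer
  polynomial equations in the labels `y` (`aeval_universal_eq_iff`: compare `x`-coefficients).
* `exists_complex_solution_of_twoAdic`: an integer system solvable in every `R_k` is solvable in the
  product ring `A = Π_k R_k`; the powers of `2` are non-zero in `A` (look at coordinate `k`), so some
  prime ideal `P` avoids them (`Ideal.exists_le_prime_disjoint`); every odd integer is a unit in each
  `R_k` (Bézout against a vanishing power of `2`), hence in `A`, hence non-zero modulo `P`; so the
  domain `A ⧸ P` has characteristic `0`, the system is solvable in the characteristic-`0` field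
  `Frac(A ⧸ P)`, and therefore over `ℂ` (`exists_complex_solution_of_charZero`, Bürgisser's
  Nullstellensatz transfer, already in the tree).
* Projections are free (`complexity_le_of_isProjection`) and extension of scalars is free
  (`complexity_map_le`), so `L_ℂ(f₀) ≤ L_ℤ(U) ≤ 21877 (N + d + s + 2)²⁶`.

Honest framing: bookkeeping for a conditional route (calibration: the 2-adic precision ladder is
not stronger than the summit); `VP ≠ VNP` is NOT proved and nothing here is progress on it.

## References

* P. Bürgisser, *Completeness and Reduction in Algebraic Complexity Theory* (2000), §4.1 (the truth
  of `VP = VNP` over algebraically closed fields depends only on the characteristic; extension of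
  scalars), Rem. 2.7 (projections). [cite: Burgisser2000, §4.1]
* R. Raz, *Elusive functions and lower bounds for arithmetic circuits*, Theory Comput. 6 (2010),
  Prop. 2.8, Prop. 3.3 (universal circuit). [cite: Raz2010, Prop. 3.3]
* P. Bürgisser, *Cook's versus Valiant's hypothesis*, TCS 235 (2000), §5 (A3) (Nullstellensatz
  transfer to `ℂ`). [cite: Burgisser2000TCS, §5 (A3)]
-/

set_option linter.dupNamespace false

noncomputable section

open MvPolynomial

namespace Summit.ValiantsHypothesis.ValiantsHypothesis.Theorems.TwoAdicLadder

open Literature.Computability.AlgebraicComplexity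

/-! ### §1. Integer polynomial systems: from 2-adically deep rings to `ℂ` -/

section Systems

/-- Evaluation of an integer polynomial does not depend on the `ℤ`-algebra structure used: it is
`eval₂` along the canonical map `ℤ → A`. [folklore] -/
theorem aeval_eq_eval₂_int {A : Type*} [CommRing A] {_inst : Algebra ℤ A} {τ : Type*} (z : τ → A)
    (q : MvPolynomial τ ℤ) : aeval z q = eval₂ (Int.castRingHom A) z q := by
  rw [MvPolynomial.aeval_def, Subsingleton.elim (algebraMap ℤ A) (Int.castRingHom A)]

/-- A ring homomorphism commutes with the evaluation of an integer polynomial. [folklore] -/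
theorem ringHom_eval₂_int {A B : Type*} [CommRing A] [CommRing B] {τ : Type*} (φ : A →+* B)
    (z : τ → A) (q : MvPolynomial τ ℤ) :
    φ (eval₂ (Int.castRingHom A) z q) = eval₂ (Int.castRingHom B) (fun i => φ (z i)) q := by
  have key : φ.comp (eval₂Hom (Int.castRingHom A) z) =
      eval₂Hom (Int.castRingHom B) (fun i => φ (z i)) :=
    MvPolynomial.ringHom_ext (fun r => by simp) (fun i => by simp)
  exact RingHom.congr_fun key q

/-- Where `2` is nilpotent, every odd integer is a unit (Bézout: `a·m + b·2^N = 1`). [folklore] -/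
theorem isUnit_natCast_of_odd_of_isNilpotent_two {B : Type*} [CommRing B]
    (h2 : IsNilpotent (2 : B)) {m : ℕ} (hm : Odd m) : IsUnit (m : B) := by
  obtain ⟨N, hN⟩ := h2
  obtain ⟨a, rfl⟩ := hm
  have hcop : IsCoprime ((2 * a + 1 : ℕ) : ℤ) ((2 : ℤ) ^ N) := by
    apply IsCoprime.pow_right
    refine ⟨1, -(a : ℤ), ?_⟩
    push_cast
    ring
  have hB := hcop.map (Int.castRingHom B)
  rw [map_pow, map_natCast, map_ofNat, hN, isCoprime_zero_right] at hB
  exact hB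

/-- **Transfer of solvability, 2-adically deep rings ⇒ `ℂ`.** An integer polynomial system
that is solvable in commutative rings `R₀, R₁, …` with `2` nilpotent in every `R_k` and `2^k ≠ 0`
in `R_k` is solvable over `ℂ`: solve it in the product ring `A = Π R_k`, pass to `A ⧸ P` for a
prime `P` avoiding the powers of `2` (a characteristic-`0` domain, odd integers being units of
`A`), then to its fraction field, then to `ℂ` by Bürgisser's Nullstellensatz transfer
`exists_complex_solution_of_charZero`. (The ultrafilter-free form of the planner's ultraproduct
step for `LadderOfVH`.) [cite: Burgisser2000, §4.1] -/
theorem exists_complex_solution_of_twoAdic {m s : ℕ} (S : Fin s → MvPolynomial (Fin m) ℤ)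
    (R : ℕ → Type) [∀ k, CommRing (R k)] (h2 : ∀ k, IsNilpotent (2 : R k))
    (hk : ∀ k, (2 : R k) ^ k ≠ 0)
    (hsol : ∀ k, ∃ z : Fin m → R k, ∀ i, eval₂ (Int.castRingHom (R k)) z (S i) = 0) :
    ∃ z : Fin m → ℂ, ∀ i, eval₂ (Int.castRingHom ℂ) z (S i) = 0 := by
  classical
  choose z hz using hsol
  -- the product solution in the product ring `Π R_k`
  let zA : Fin m → (∀ k, R k) := fun j k => z k j
  have hzA : ∀ i, eval₂ (Int.castRingHom (∀ k, R k)) zA (S i) = 0 := by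
    intro i
    funext k
    have h := ringHom_eval₂_int (Pi.evalRingHom R k) zA (S i)
    rw [Pi.evalRingHom_apply] at h
    rw [Pi.zero_apply, h]
    exact hz k i
  -- the powers of `2` are non-zero in `Π R_k`
  have hpow : ∀ j, (2 : ∀ k, R k) ^ j ≠ 0 := by
    intro j h
    apply hk j
    have := congrFun h j
    simpa using this
  have hdisj : Disjoint ((⊥ : Ideal (∀ k, R k)) : Set (∀ k, R k))
      (Submonoid.powers (2 : ∀ k, R k)) := by
    refine Set.disjoint_left.mpr ?_
    rintro x hx ⟨j, rfl⟩
    simp only [SetLike.mem_coe, Ideal.mem_bot] at hx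
    exact hpow j hx
  obtain ⟨P, hP, -, hPdisj⟩ :=
    Ideal.exists_le_prime_disjoint (⊥ : Ideal (∀ k, R k)) (Submonoid.powers 2) hdisj
  -- `(Π R_k) ⧸ P` is a domain of characteristic zero
  have h2Q : ∀ j, (2 : (∀ k, R k) ⧸ P) ^ j ≠ 0 := by
    intro j h
    have hmem : (2 : ∀ k, R k) ^ j ∈ P := by
      rw [← Ideal.Quotient.eq_zero_iff_mem, map_pow, map_ofNat]
      exact h
    exact Set.disjoint_left.mp hPdisj hmem ⟨j, rfl⟩
  have hoddQ : ∀ q : ℕ, Odd q → (q : (∀ k, R k) ⧸ P) ≠ 0 := by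
    intro q hq h
    have hu : IsUnit (q : ∀ k, R k) := by
      refine Pi.isUnit_iff.mpr fun k => ?_
      rw [Pi.natCast_apply]
      exact isUnit_natCast_of_odd_of_isNilpotent_two (h2 k) hq
    have hmem : (q : ∀ k, R k) ∈ P := by
      rw [← Ideal.Quotient.eq_zero_iff_mem, map_natCast]
      exact h
    exact hP.ne_top (P.eq_top_of_isUnit_mem hmem hu)
  haveI : CharZero ((∀ k, R k) ⧸ P) := by
    refine charZero_of_inj_zero fun q hq => ?_
    by_contra hq0
    obtain ⟨a, b, hb, rfl⟩ := Nat.exists_eq_two_pow_mul_odd hq0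
    rw [Nat.cast_mul, Nat.cast_pow, Nat.cast_ofNat] at hq
    rcases mul_eq_zero.mp hq with h | h
    · exact h2Q a h
    · exact hoddQ b hb h
  -- the fraction field, and the solution there
  haveI : CharZero (FractionRing ((∀ k, R k) ⧸ P)) :=
    charZero_of_injective_algebraMap (IsFractionRing.injective ((∀ k, R k) ⧸ P) _)
  let ψ : (∀ k, R k) →+* FractionRing ((∀ k, R k) ⧸ P) :=
    (algebraMap ((∀ k, R k) ⧸ P) _).comp (Ideal.Quotient.mk P)
  obtain ⟨ζ, hζ⟩ :=
    exists_complex_solution_of_charZero (k := FractionRing ((∀ k, R k) ⧸ P)) S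
      ⟨fun j => ψ (zA j), fun i => by
        rw [aeval_eq_eval₂_int, ← ringHom_eval₂_int, hzA, map_zero]⟩
  refine ⟨ζ, fun i => ?_⟩
  have h := hζ i
  rw [aeval_eq_eval₂_int] at h
  exact h

end Systems

/-! ### §2. The universal circuit turns "small circuit over `R`" into an integer system -/

section Universal

variable {N p : ℕ}

/-- **Specialising the labels of the integer universal polynomial = base-changing its
`x`-coefficients along `aeval α`**: for `U ∈ ℤ[x ⊕ y]` read as `V = U ∈ (ℤ[y])[x]`
(`sumAlgEquiv`), `U_R(x, α) = Σ_m (coeff_m V)(α) x^m` over every commutative ring `R`. [folklore] -/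
theorem aeval_map_eq_map_sumAlgEquiv {B : Type*} [CommRing B] (U : MvPolynomial (Fin N ⊕ Fin p) ℤ)
    (α : Fin p → B) :
    aeval (Sum.elim X fun j => C (α j)) (MvPolynomial.map (Int.castRingHom B) U) =
      MvPolynomial.map (aeval α).toRingHom (sumAlgEquiv ℤ (Fin N) (Fin p) U) := by
  set φ : MvPolynomial (Fin N ⊕ Fin p) B →ₐ[B] MvPolynomial (Fin N) B :=
    aeval (Sum.elim X fun j => C (α j)) with hφ
  have key : φ.toRingHom.comp (MvPolynomial.map (Int.castRingHom B)) =
      (MvPolynomial.map (aeval α).toRingHom).comp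
        (sumAlgEquiv ℤ (Fin N) (Fin p)).toRingEquiv.toRingHom := by
    refine MvPolynomial.ringHom_ext (fun r => ?_) (fun i => ?_)
    · simp [hφ]
    · rcases i with i | j
      · simp [hφ, sumAlgEquiv_X_inl]
      · simp [hφ, sumAlgEquiv_X_inr]
  exact RingHom.congr_fun key U

/-- The integer equations attached to `U ∈ ℤ[x ⊕ y]` and a target `f₀ ∈ ℤ[x]`: for each exponent
`m`, `E_m(y) = coeff_m(U as a polynomial in x) − coeff_m(f₀) ∈ ℤ[y]`; and `U_R(x, α) = f₀` over a
commutative ring `R` iff `E_m(α) = 0` for all `m` (coefficient comparison). [folklore] -/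
theorem aeval_universal_eq_iff {B : Type*} [CommRing B] (U : MvPolynomial (Fin N ⊕ Fin p) ℤ)
    (f₀ : MvPolynomial (Fin N) ℤ) (α : Fin p → B) :
    aeval (Sum.elim X fun j => C (α j)) (MvPolynomial.map (Int.castRingHom B) U) =
        MvPolynomial.map (Int.castRingHom B) f₀ ↔
      ∀ m : Fin N →₀ ℕ,
        aeval α (coeff m (sumAlgEquiv ℤ (Fin N) (Fin p) U) - C (coeff m f₀)) = 0 := by
  rw [aeval_map_eq_map_sumAlgEquiv, MvPolynomial.ext_iff]
  refine forall_congr' fun m => ?_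
  rw [coeff_map, coeff_map, map_sub, aeval_C, sub_eq_zero]
  simp [algebraMap_int_eq, eq_intCast]

/-- The equations with `m` outside the supports of `U` (in `x`) and of `f₀` are `0 = 0`.
[folklore] -/
theorem universal_eq_trivial (U : MvPolynomial (Fin N ⊕ Fin p) ℤ) (f₀ : MvPolynomial (Fin N) ℤ)
    {m : Fin N →₀ ℕ}
    (hm : m ∉ (sumAlgEquiv ℤ (Fin N) (Fin p) U).support ∪ f₀.support) :
    coeff m (sumAlgEquiv ℤ (Fin N) (Fin p) U) - C (coeff m f₀) = 0 := by
  rw [Finset.mem_union, not_or, notMem_support_iff, notMem_support_iff] at hm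
  rw [hm.1, hm.2, C_0, sub_zero]

end Universal

/-! ### §3. The complexity transfer -/

/-- The total degree does not increase under a change of coefficients. [folklore] -/
theorem totalDegree_map_le_int {B : Type*} [CommRing B] {N : ℕ} (f₀ : MvPolynomial (Fin N) ℤ) :
    (MvPolynomial.map (Int.castRingHom B) f₀).totalDegree ≤ f₀.totalDegree :=
  Finset.sup_mono (support_map_subset _ _)

/-- **Small circuits over 2-adically deep rings give a small circuit over `ℂ`.** If an integer
polynomial `f₀ ∈ ℤ[x₁,…,x_N]` has fan-in-two circuits of size `≤ s` over commutative rings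
`R₀, R₁, …` with `2` nilpotent in every `R_k` and `2^k ≠ 0` in `R_k`, then
`L_ℂ(f₀) ≤ 21877 · (N + deg f₀ + s + 2)²⁶`. Route `TwoAdicLadder`, the engine of `LadderOfVH`
(planner: "ultraproduct `S = ∏_k R_{n,k}/U` … Łoś on finitely many shapes … `Ω ≃ ℂ`"; here: Raz's
universal circuit over `ℤ`, a prime ideal of `Π R_k` avoiding `2^ℕ`, and the Nullstellensatz
transfer to `ℂ`). [cite: Burgisser2000, §4.1] -/
theorem complexity_map_complex_le_of_twoAdic {N : ℕ} (f₀ : MvPolynomial (Fin N) ℤ) (s : ℕ)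
    (R : ℕ → Type) [∀ k, CommRing (R k)] (h2 : ∀ k, IsNilpotent (2 : R k))
    (hk : ∀ k, (2 : R k) ^ k ≠ 0)
    (hc : ∀ k, complexity (MvPolynomial.map (Int.castRingHom (R k)) f₀) ≤ s) :
    complexity (MvPolynomial.map (Int.castRingHom ℂ) f₀) ≤
      21877 * (N + f₀.totalDegree + s + 2) ^ 26 := by
  classical
  obtain ⟨p, U, -, hU, -, -, huniv⟩ :=
    RazUniversal.exists_universalCircuit_int.{0} N s f₀.totalDegree
  -- the integer system
  set V := sumAlgEquiv ℤ (Fin N) (Fin p) U with hV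
  let M : Finset (Fin N →₀ ℕ) := V.support ∪ f₀.support
  let E : (Fin N →₀ ℕ) → MvPolynomial (Fin p) ℤ := fun m => coeff m V - C (coeff m f₀)
  let Sys : Fin M.card → MvPolynomial (Fin p) ℤ := fun i => E (M.equivFin.symm i)
  -- solvable in every `R k`
  have hsol : ∀ k, ∃ z : Fin p → R k, ∀ i, eval₂ (Int.castRingHom (R k)) z (Sys i) = 0 := by
    intro k
    obtain ⟨α, hα⟩ := huniv (R k) (MvPolynomial.map (Int.castRingHom (R k)) f₀)
      (totalDegree_map_le_int f₀) (hc k)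
    refine ⟨α, fun i => ?_⟩
    have h := (aeval_universal_eq_iff U f₀ α).mp hα (M.equivFin.symm i)
    rw [aeval_eq_eval₂_int] at h
    exact h
  -- hence solvable over `ℂ`
  obtain ⟨ζ, hζ⟩ := exists_complex_solution_of_twoAdic Sys R h2 hk hsol
  have hall : ∀ m : Fin N →₀ ℕ, aeval ζ (E m) = 0 := by
    intro m
    by_cases hm : m ∈ M
    · have := hζ (M.equivFin ⟨m, hm⟩)
      rw [aeval_eq_eval₂_int]
      simpa [Sys] using this
    · change aeval ζ (coeff m V - C (coeff m f₀)) = 0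
      rw [universal_eq_trivial U f₀ hm, map_zero]
  have hspec : aeval (Sum.elim X fun j => C (ζ j)) (MvPolynomial.map (Int.castRingHom ℂ) U) =
      MvPolynomial.map (Int.castRingHom ℂ) f₀ := (aeval_universal_eq_iff U f₀ ζ).mpr hall
  -- projections and extension of scalars are free
  have hproj : IsProjection (MvPolynomial.map (Int.castRingHom ℂ) f₀)
      (MvPolynomial.map (Int.castRingHom ℂ) U) := by
    refine ⟨Sum.elim X fun j => C (ζ j), fun i => ?_, hspec.symm⟩
    rcases i with i | j
    · exact Or.inl ⟨i, rfl⟩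
    · exact Or.inr ⟨ζ j, rfl⟩
  calc complexity (MvPolynomial.map (Int.castRingHom ℂ) f₀)
      ≤ complexity (MvPolynomial.map (Int.castRingHom ℂ) U) := complexity_le_of_isProjection hproj
    _ ≤ complexity U := ArithCircuit.complexity_map_le _ _
    _ ≤ 21877 * (N + f₀.totalDegree + s + 2) ^ 26 := hU

end Summit.ValiantsHypothesis.ValiantsHypothesis.Theorems.TwoAdicLadder

end
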